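import Literature.Analysis.FluidPDE.FluidComputer.GalerkinEnergyBalance

/-!
# Interpolation inequalities between energy, enstrophy and palinstrophy of a truncated field

For ANY coefficient field on a finite mode set `S` (no dynamics), with `E_S = ½Σ|û|²`,
`Z_S = ½Σ|k|²|û|²`, `P_S = ½Σ|k|⁴|û|²` (the three quadratic diagnostics a spectral code prints — dns-B's
`E`, `Z`, `P` columns):

* `truncEnstrophy_sq_le` — **`Z_S² ≤ E_S · P_S`** (Cauchy–Schwarz with weights `½|û(k)|²`): the
  enstrophy is at most the geometric mean of energy and palinstrophy; equivalently the viscous enstrophy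
  loss rate satisfies `2νP_S ≥ 2ν Z_S²/E_S`;
* `truncEnstrophy_le_truncPalinstrophy` — `Z_S ≤ P_S` when `1 ≤ |k|²` on `S`;
* `truncPalinstrophy_le` — `P_S ≤ K² Z_S` when `|k|² ≤ K²` on `S`;
* `enstrophy_dissipation_lower` — along an unforced Galerkin solution, the enstrophy equation
  `dZ_S/dt = -2νP_S + T_Z` (`hasDerivAt_truncEnstrophy_galerkin`) therefore reads
  `dZ_S/dt ≤ -2ν Z_S²/E_S + T_Z` whenever `E_S > 0`.

[folklore: Cauchy–Schwarz / Poincaré on a finite spectrum; the form `P ≥ Z²/E` is the standard first step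
of every enstrophy-growth estimate] Row-level use (ATLAS/REFEREE): every
diag row of either engine must satisfy `Z² ≤ E·P`, `Z ≤ P ≤ 3K²·Z` (cubic mask `|k_i| ≤ K`) up to
round-off. 0 sorry, 0 named facts. HONEST FRAMING: typed infrastructure for a low prior, high
value-of-information experiment on Tao's machine paradigm; NOT a claim that NS blows up.
-/

noncomputable section

namespace Literature.Analysis.FluidPDE.FluidComputer

open Finset
open scoped BigOperators

namespace ShellTransfer

/-- **`Z_S² ≤ E_S · P_S`** (Cauchy–Schwarz). [folklore] -/
theorem truncEnstrophy_sq_le (U : FourierVelocity) (S : Finset (Fin 3 → ℤ)) :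
    truncEnstrophy U S ^ 2 ≤ truncEnergy U S * truncPalinstrophy U S := by
  unfold truncEnstrophy truncEnergy truncPalinstrophy
  refine Finset.sum_sq_le_sum_mul_sum_of_sq_le_mul S (fun k _ => modalEnergy_nonneg U k)
    (fun k _ => mul_nonneg (sq_nonneg _) (modalEnergy_nonneg U k)) fun k _ => ?_
  have := modalEnergy_nonneg U k
  nlinarith

/-- `Z_S ≤ P_S` when every retained wavevector has `1 ≤ |k|²`. [folklore] -/
theorem truncEnstrophy_le_truncPalinstrophy (U : FourierVelocity) (S : Finset (Fin 3 → ℤ))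
    (h1 : ∀ k ∈ S, 1 ≤ knormSq k) : truncEnstrophy U S ≤ truncPalinstrophy U S := by
  unfold truncEnstrophy truncPalinstrophy
  refine Finset.sum_le_sum fun k hk => ?_
  have he := modalEnergy_nonneg U k
  have hk1 := h1 k hk
  have : knormSq k ≤ knormSq k ^ 2 := by nlinarith
  exact mul_le_mul_of_nonneg_right this he

/-- `P_S ≤ K² Z_S` when every retained wavevector has `|k|² ≤ K²`. [folklore] -/
theorem truncPalinstrophy_le (U : FourierVelocity) (S : Finset (Fin 3 → ℤ)) {K2 : ℝ}
    (hK : ∀ k ∈ S, knormSq k ≤ K2) : truncPalinstrophy U S ≤ K2 * truncEnstrophy U S := by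
  unfold truncEnstrophy truncPalinstrophy
  rw [Finset.mul_sum]
  refine Finset.sum_le_sum fun k hk => ?_
  have he := modalEnergy_nonneg U k
  have hk0 := knormSq_nonneg k
  have : knormSq k ^ 2 ≤ K2 * knormSq k := by nlinarith [hK k hk]
  calc knormSq k ^ 2 * modalEnergy U k ≤ (K2 * knormSq k) * modalEnergy U k :=
        mul_le_mul_of_nonneg_right this he
    _ = K2 * (knormSq k * modalEnergy U k) := by ring

/-- The palinstrophy dominates `Z²/E`: `Z_S²/E_S ≤ P_S` when `E_S > 0`. [folklore] -/
theorem truncEnstrophy_sq_div_le (U : FourierVelocity) (S : Finset (Fin 3 → ℤ))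
    (hE : 0 < truncEnergy U S) : truncEnstrophy U S ^ 2 / truncEnergy U S ≤ truncPalinstrophy U S := by
  rw [div_le_iff₀ hE, mul_comm]
  exact truncEnstrophy_sq_le U S

/-- **Enstrophy equation with the dissipation bounded below**: along an unforced Galerkin solution with
`ν ≥ 0` and `E_S(t) > 0`, `dZ_S/dt ≤ -2ν Z_S²/E_S + T_Z` where `T_Z = enstrophyTransfer` is the
production term of `hasDerivAt_truncEnstrophy_galerkin`. [folklore] -/
theorem deriv_truncEnstrophy_le {U : ℝ → FourierVelocity} {S : Finset (Fin 3 → ℤ)} {ν : ℝ} (hν : 0 ≤ ν)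
    {c : ℝ → (Fin 3 → ℤ) → ℂ} (hU : IsGalerkinSolution U S ν c fun _ _ _ => 0) (t : ℝ)
    (hE : 0 < truncEnergy (U t) S) :
    deriv (fun s => truncEnstrophy (U s) S) t ≤
      -(2 * ν) * (truncEnstrophy (U t) S ^ 2 / truncEnergy (U t) S) + enstrophyTransfer (U t) S := by
  have h := hasDerivAt_truncEnstrophy_galerkin hU t
  rw [h.deriv]
  have hP := truncEnstrophy_sq_div_le (U t) S hE
  have h0 : enstrophyInjection (U t) ((fun (_ : ℝ) (_ : Fin 3 → ℤ) (_ : Fin 3) => (0 : ℂ)) t) S = 0 := by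
    unfold enstrophyInjection cdot
    simp
  rw [h0, add_zero]
  nlinarith

end ShellTransfer

end Literature.Analysis.FluidPDE.FluidComputer

end
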